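import Summits.QuantumFields.BalabanUV.T4Continuum.Support.VariationalVectorOneMinCentredReg
import Summits.QuantumFields.BalabanUV.T4Continuum.Support.VariationalVectorEndMonotone

/-!
# T⁴ programme, spine node NE2 (U1a), lane P2 — «V-ONE-G SUMMABLE», file D: THE PER-LEVEL UPPER BRACKET FOR BAŁABAN's PROJECTED FUNCTIONAL WITH THE
# CENTRED COMPETITOR — `hONEm_centred_reg` ∘ `hREG_action` plugged into leaf-10-g3's `vector_upper_bracket_min` IN THE KERNEL (junction), and `0 ≤ ε⋆`
# (model level, `E = ℂ` for the bracket; cell `pub-balaban`)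

NE2 formalisation swarm `b2b-balaban-t4-ne2-formalise-*`, leaf prover 01 GEN 9 (`prover-b2b-balaban-t4-ne2-formalise-leaf-01-g9-0`); journal INTENT
«V-ONE-G SUMMABLE» CLAIMS.log 2026-08-20 l.20284.  On top of file B `VariationalVectorOneMinCentredReg` (p235562: `hONEm_centred_reg`, `hREG_action`) and leaf-10-g3's
`VariationalVectorEndMonotone` (p226720 ∕ p227472: `vector_upper_bracket_min`, with `VariationalVectorEndOfLeaves.ePV`) BY NAME; nothing defined.

WHAT.
 * §1 **`epsStar_nonneg`**: file B's explicit coefficient `ε⋆` (same `let`s) is `≥ 0` for nonnegative constants and `s, t, u > 0` (the END's `hε₁`).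
 * §2 **`vector_upper_bracket_centred`** (`E = ℂ`): with file B's hypotheses plus the COARSE vector V-UB `hUBcV` (constant `Λ_V`), for every unit datum `φ`:
   `blockSpin (Q_k ∘ Q₁) (SfV R′ G′) φ ≤ blockSpin Q_k (ScV Rc G) φ + ePV Λ_V C_Pᵛ 1 ε⋆ δ′ · nsqV φ`,
   `Q_k = QvL T_k`, `Q₁ = QvL L (frameT T′ Rc)`, `G = projG Rc (ker Q_T)`, `G′ = projG R′ (ker (Q_T ∘ Q_{T′}))`, `δ′ = √(8d(1+d²))·(nLm₁)` — i.e. the monotone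
   END's one-step input `Δ_{k+1}(φ) ≤ Δ_k(φ) + e′_k‖φ‖²` for Bałaban's projected functional and the centred competitor, with `e′_k = ePV Λ_V C_Pᵛ 1 ε⋆_k δ′_k`,
   is a KERNEL consequence of the displayed leaves (V-UB coarse ∕ fine, V-P, (Går), (GF3), V-REG, the scalar pair's UB⁺∕P⁺∕REG⁺) — the junction of file B with
   the END's socket checked by the kernel, not by eye.  What remains for `effV_tendsto_of_upper(_geom)` is the tower transport bookkeeping (`hTcomp ∕ hRtr ∕ hGtr`)
   and the decay class of file C (`epsStar_class_le`).

HONEST FRAMING (T4-DAG p. 1).  Model level (c5; `E = ℂ` in §2); [folklore] plumbing; leaves DISPLAYED, nothing with background discharged; no `def`, no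
`def … : Prop`, no `sorry`; axioms standard.  V-END with background ∕ NE2 NOT proved; NE3 OPEN; spine PROVED 0∕9 unchanged; rung (B)+1 on a fixed finite
T⁴ — NOT infinite volume, NOT mass gap, NOT Clay.  HONEST DEPENDENCY (cell, verbatim): continuum YM on T⁴ ⇐ BetaPertH ∧ nine spine estimates (0/9 proved);
BetaPertH ⇐ (D1) ∧ (D4) ∧ CAP+tail; G-an2-4 gates asym, D1 and NE2/3/4.
-/

noncomputable section

namespace Summit.QuantumFields.BalabanUV.T4Continuum.VariationalVectorOneMinCentredBracket

open Finset WithLp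
open Literature.MathematicalPhysics.QuantumFieldTheory.Balaban1983to89
open Literature.MathematicalPhysics.QuantumFieldTheory.Balaban1983to89.B5Prop11Plancherel (Tor fine unitVec)
open Literature.MathematicalPhysics.QuantumFieldTheory.Balaban1983to89.B5Block118 (bpt)
open Summit.QuantumFields.BalabanUV.T4Continuum.VariationalTransfer (blockSpin)
open Summit.QuantumFields.BalabanUV.T4Continuum.VariationalColourFederbush (cDv misv)
open Summit.QuantumFields.BalabanUV.T4Continuum.VariationalColourUpperBound (nsqv)
open Summit.QuantumFields.BalabanUV.T4Continuum.VariationalColourInterpolant (interpv)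
open Summit.QuantumFields.BalabanUV.T4Continuum.VariationalColourOneStepPhys (rhov)
open Summit.QuantumFields.BalabanUV.T4Continuum.VariationalColourScalarPair (Scv Sfv qWv qVv Qkv Q1v)
open Summit.QuantumFields.BalabanUV.T4Continuum.VariationalVectorInterpolant (frameT)
open Summit.QuantumFields.BalabanUV.T4Continuum.VectorBlockTrialForm (QvL nsqV nsqV_nonneg roughV)
open Summit.QuantumFields.BalabanUV.T4Continuum.VariationalVectorForm (ScV SfV qWV ScV_nonneg)
open Summit.QuantumFields.BalabanUV.T4Continuum.VariationalVectorWeitzenbock (divV divSq)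
open Summit.QuantumFields.BalabanUV.T4Continuum.VariationalVectorGaugeSlice (sliceSub projG projG_nonneg continuous_projG avgOp)
open Summit.QuantumFields.BalabanUV.T4Continuum.VariationalVectorOneStep (hessV)
open Summit.QuantumFields.BalabanUV.T4Continuum.VariationalVectorOneStepPhys (rhoV)
open Summit.QuantumFields.BalabanUV.T4Continuum.VariationalVectorAverage (continuous_QvL)
open Summit.QuantumFields.BalabanUV.T4Continuum.VariationalVectorEndOfLeaves (ePV)
open Summit.QuantumFields.BalabanUV.T4Continuum.VariationalVectorEndMonotone (vector_upper_bracket_min)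
open Summit.QuantumFields.BalabanUV.T4Continuum.VariationalVectorOneMinCentredReg (hONEm_centred_reg hREG_action)

variable {d : ℕ} (n L : ℕ) [NeZero n] [NeZero L] (M : Fin d → ℕ) [hM : ∀ μ, NeZero (M μ)]

/-! ## §1 `0 ≤ ε⋆` -/

omit hM [NeZero L] in
/-- **`0 ≤ ε⋆`** (file B's `let`s verbatim). [folklore] -/
theorem epsStar_nonneg {m m₁ p Λ CP CR Λv CRv CPv CGar CGar' CD CD' s t u : ℝ} (hm : 0 ≤ m) (hm₁ : 0 ≤ m₁) (hΛ : 0 ≤ Λ)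
    (hCP : 0 ≤ CP) (hCR : 0 ≤ CR) (hΛv : 0 ≤ Λv) (hCRv : 0 ≤ CRv) (hCPv : 0 ≤ CPv) (hCGar : 0 ≤ CGar) (hCGar' : 0 ≤ CGar') (hCD : 0 ≤ CD)
    (hCD' : 0 ≤ CD') (hs : 0 < s) (ht : 0 < t) (hu : 0 < u) :
    let eH : ℝ := (((d : ℝ) / 4 + 1 / 2) * ((L : ℝ) / (n : ℝ) ^ 2)) * CR * (Λ + 1)
        + 2 * (Real.sqrt (2 * d * (1 + (d : ℝ) ^ 2)) * ((n : ℝ) * L * m₁))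
          * Real.sqrt ((Λ + (((d : ℝ) / 4 + 1 / 2) * ((L : ℝ) / (n : ℝ) ^ 2)) * CR * (Λ + 1)) * (CP * (Λ + 1)))
        + (Real.sqrt (2 * d * (1 + (d : ℝ) ^ 2)) * ((n : ℝ) * L * m₁)) ^ 2 * (CP * (Λ + 1))
        + 2 * (Real.sqrt d * ((n : ℝ) * m)) * Real.sqrt (Λ * (CP * (Λ + 1)))
    let e₂ : ℝ := t + 3 * (1 + t⁻¹) * (8 * d * (((n : ℝ) ^ 2)⁻¹ * CRv
          + (1 + m₁) ^ 2 * ((d : ℝ) / 4 * L * (((n : ℝ) ^ 2)⁻¹ * CRv)) + m₁ ^ 2 * (CGar + CGar')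
          + m₁ ^ 2 * (2 * (1 + (d : ℝ) ^ 2) * (L : ℝ) ^ 2 * ((n : ℝ) ^ 2 * CPv)))
        + (d : ℝ) / 2 * (2 * d * (((n : ℝ) ^ 2)⁻¹ * CRv) + 2 * (d : ℝ) ^ 2 * p ^ 2 * ((n : ℝ) ^ 2 * CPv))
        + (d : ℝ) / 4 * (2 * (2 * d * (((n : ℝ) ^ 2)⁻¹ * CRv) + 2 * (d : ℝ) ^ 2 * p ^ 2 * ((n : ℝ) ^ 2 * CPv)) + 2 * (Λ * ((n : ℝ) ^ 2)⁻¹ * (CD + CD')))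
        + CP * eH * (CD + CD'))
    let ε : ℝ := u + (1 + u) * ((s + (1 + s⁻¹) * (d * (L : ℝ) / (n : ℝ) ^ 2)) * (1 + CRv) + e₂)
      + (1 + u⁻¹) * (Λv * (25 / 4 * (((n : ℝ) ^ 2)⁻¹ * (CGar + CGar'))))
    0 ≤ ε := by
  intro eH e₂ ε
  have hn : (0 : ℝ) < n := by exact_mod_cast Nat.pos_of_ne_zero (NeZero.ne n)
  positivity

/-! ## §2 The per-level upper bracket for `projG` with the centred competitor (`E = ℂ`) -/

/-- **THE UPPER BRACKET FOR BAŁABAN's PROJECTED FUNCTIONAL WITH THE CENTRED COMPETITOR** (`E = ℂ`; file B's hypotheses + the COARSE vector V-UB `hUBcV`):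
`blockSpin (Q_k ∘ Q₁) (SfV R′ G′) φ ≤ blockSpin Q_k (ScV Rc G) φ + ePV Λ_V C_Pᵛ 1 ε⋆ δ′ · nsqV φ` — leaf-10-g3's `vector_upper_bracket_min` with
`hONEm := hONEm_centred_reg`, `hREG := hREG_action` (`ρ := ScV + nsqV ∘ Q_k`, `C_R = 1`, `ε₁ = ε⋆`, `δ′ = √(8d(1+d²))·nLm₁`). [folklore] -/
theorem vector_upper_bracket_centred (hd : 1 ≤ d) {Rc : Tor (fine n M) → Fin d → (ℂ →L[ℂ] ℂ)} {R' : Tor (fine L (fine n M)) → Fin d → (ℂ →L[ℂ] ℂ)}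
    {T : Tor (fine n M) → (ℂ →L[ℂ] ℂ)} {T' : Tor (fine L (fine n M)) → (ℂ →L[ℂ] ℂ)} {Tk : Tor M → (Fin d → Fin n) → Fin n → Fin d → (ℂ →L[ℂ] ℂ)}
    (hT : ∀ x, T x ∈ unitary (ℂ →L[ℂ] ℂ)) (hT' : ∀ x, T' x ∈ unitary (ℂ →L[ℂ] ℂ)) (hRc : ∀ y μ, Rc y μ ∈ unitary (ℂ →L[ℂ] ℂ))
    (hR1 : ∀ x μ, R' x μ ∈ unitary (ℂ →L[ℂ] ℂ)) (hTk : ∀ y j t' μ, ‖Tk y j t' μ‖ ≤ 1)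
    {p : ℝ} (hp : 0 ≤ p) (hP : ∀ x μ ν, ‖Rc x μ * Rc (x + unitVec (fine n M) μ) ν - Rc x ν * Rc (x + unitVec (fine n M) ν) μ‖ ≤ p)
    {m : ℝ} (hm : 0 ≤ m) (hmis : ∀ y μ j, ‖misv L (fine n M) Rc R' T' y μ j‖ ≤ m)
    {m₁ : ℝ} (hm₁ : 0 ≤ m₁)
    (hin : ∀ (y : Tor (fine n M)) (j : Fin d → Fin L) (μ : Fin d), (j μ : ℕ) + 1 < L →
      ‖R' (bpt L (fine n M) y j) μ * star (T' (bpt L (fine n M) y j + unitVec (fine L (fine n M)) μ)) - star (T' (bpt L (fine n M) y j))‖ ≤ m₁)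
    (hcross : ∀ (y : Tor (fine n M)) (j : Fin d → Fin L) (μ : Fin d), (j μ : ℕ) + 1 = L →
      ‖R' (bpt L (fine n M) y j) μ * star (T' (bpt L (fine n M) y j + unitVec (fine L (fine n M)) μ))
        - star (T' (bpt L (fine n M) y j)) * Rc y μ‖ ≤ m₁)
    -- the scalar pair's leaves (both levels), as in `oneG_centred_le`
    {Λ CP CR : ℝ} (hΛ : 0 ≤ Λ) (hCP : 0 ≤ CP) (hCR : 0 ≤ CR)
    (hUBc : ∀ ψ : Tor M → ℂ, ∃ f, Qkv n M T f = ψ ∧ Scv n M Rc f ≤ Λ * nsqv ψ)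
    (hUBf : ∀ ψ : Tor M → ℂ, ∃ g, Qkv n M T (Q1v n L M T' g) = ψ ∧ Sfv n L M R' g ≤ Λ * nsqv ψ)
    (hPc : ∀ f, qWv n M f ≤ CP * (Scv n M Rc f + nsqv (Qkv n M T f)))
    (hPf : ∀ g, qVv n L M g ≤ CP * (Sfv n L M R' g + nsqv (Qkv n M T (Q1v n L M T' g))))
    (hREG : ∀ (ψ : Tor M → ℂ) f, Qkv n M T f = ψ → (∀ f₂, Qkv n M T f₂ = ψ → Scv n M Rc f ≤ Scv n M Rc f₂) →
      rhov n M Rc f ≤ CR * (Scv n M Rc f + nsqv ψ))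
    -- the vector leaves for `G := projG Rc (ker Q_T)` on the carriers `QvL T_k` (landed shapes)
    {Λv CRv CPv CGar CGar' CD CD' : ℝ} (hΛv : 0 ≤ Λv) (hCGar : 0 ≤ CGar) (hCGar' : 0 ≤ CGar') (hCD : 0 ≤ CD) (hCD' : 0 ≤ CD')
    (hUBfV : ∀ φ : Tor M → Fin d → ℂ, ∃ W', QvL n M Tk (QvL L (fine n M) (frameT L (fine n M) T' Rc) W') = φ ∧
      SfV n L M R' (projG (fine L (fine n M)) R' (LinearMap.ker ((avgOp n M T).comp (avgOp L (fine n M) T')))) W' ≤ Λv * nsqV M φ)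
    (hPcV : ∀ W, qWV n M W ≤ CPv * (ScV n M Rc (projG (fine n M) Rc (LinearMap.ker (avgOp n M T))) W + nsqV M (QvL n M Tk W)))
    (hGar : ∀ W, ((n : ℝ) ^ d)⁻¹ * ((n : ℝ) ^ 2 * roughV n M Rc W)
      ≤ CGar * ScV n M Rc (projG (fine n M) Rc (LinearMap.ker (avgOp n M T))) W + CGar' * nsqV M (QvL n M Tk W))
    (hGdiv : ∀ W, ((n : ℝ) ^ d)⁻¹ * ((n : ℝ) ^ 2 * divSq (fine n M) Rc W)
      ≤ CD * ScV n M Rc (projG (fine n M) Rc (LinearMap.ker (avgOp n M T))) W + CD' * nsqV M (QvL n M Tk W))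
    (hREGV : ∀ (φ : Tor M → Fin d → ℂ) W, QvL n M Tk W = φ →
      (∀ W₂, QvL n M Tk W₂ = φ → ScV n M Rc (projG (fine n M) Rc (LinearMap.ker (avgOp n M T))) W
        ≤ ScV n M Rc (projG (fine n M) Rc (LinearMap.ker (avgOp n M T))) W₂) →
      rhoV n M Rc W ≤ CRv * (ScV n M Rc (projG (fine n M) Rc (LinearMap.ker (avgOp n M T))) W + nsqV M φ))
    {s t u : ℝ} (hs : 0 < s) (ht : 0 < t) (hu : 0 < u)
    {ΛV : ℝ} (hΛV : 0 ≤ ΛV) (hCRv0 : 0 ≤ CRv) (hCPv0 : 0 ≤ CPv)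
    (hUBcV : ∀ φ : Tor M → Fin d → ℂ, ∃ W, QvL n M Tk W = φ ∧ ScV n M Rc (projG (fine n M) Rc (LinearMap.ker (avgOp n M T))) W ≤ ΛV * nsqV M φ) :
    let eH : ℝ := (((d : ℝ) / 4 + 1 / 2) * ((L : ℝ) / (n : ℝ) ^ 2)) * CR * (Λ + 1)
        + 2 * (Real.sqrt (2 * d * (1 + (d : ℝ) ^ 2)) * ((n : ℝ) * L * m₁))
          * Real.sqrt ((Λ + (((d : ℝ) / 4 + 1 / 2) * ((L : ℝ) / (n : ℝ) ^ 2)) * CR * (Λ + 1)) * (CP * (Λ + 1)))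
        + (Real.sqrt (2 * d * (1 + (d : ℝ) ^ 2)) * ((n : ℝ) * L * m₁)) ^ 2 * (CP * (Λ + 1))
        + 2 * (Real.sqrt d * ((n : ℝ) * m)) * Real.sqrt (Λ * (CP * (Λ + 1)))
    let e₂ : ℝ := t + 3 * (1 + t⁻¹) * (8 * d * (((n : ℝ) ^ 2)⁻¹ * CRv
          + (1 + m₁) ^ 2 * ((d : ℝ) / 4 * L * (((n : ℝ) ^ 2)⁻¹ * CRv)) + m₁ ^ 2 * (CGar + CGar')
          + m₁ ^ 2 * (2 * (1 + (d : ℝ) ^ 2) * (L : ℝ) ^ 2 * ((n : ℝ) ^ 2 * CPv)))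
        + (d : ℝ) / 2 * (2 * d * (((n : ℝ) ^ 2)⁻¹ * CRv) + 2 * (d : ℝ) ^ 2 * p ^ 2 * ((n : ℝ) ^ 2 * CPv))
        + (d : ℝ) / 4 * (2 * (2 * d * (((n : ℝ) ^ 2)⁻¹ * CRv) + 2 * (d : ℝ) ^ 2 * p ^ 2 * ((n : ℝ) ^ 2 * CPv)) + 2 * (Λ * ((n : ℝ) ^ 2)⁻¹ * (CD + CD')))
        + CP * eH * (CD + CD'))
    let ε : ℝ := u + (1 + u) * ((s + (1 + s⁻¹) * (d * (L : ℝ) / (n : ℝ) ^ 2)) * (1 + CRv) + e₂)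
      + (1 + u⁻¹) * (Λv * (25 / 4 * (((n : ℝ) ^ 2)⁻¹ * (CGar + CGar'))))
    ∀ φ : Tor M → Fin d → ℂ,
      blockSpin (QvL n M Tk ∘ QvL L (fine n M) (frameT L (fine n M) T' Rc)) (SfV n L M R' (projG (fine L (fine n M)) R' (LinearMap.ker ((avgOp n M T).comp (avgOp L (fine n M) T'))))) φ
        ≤ blockSpin (QvL n M Tk) (ScV n M Rc (projG (fine n M) Rc (LinearMap.ker (avgOp n M T)))) φ
          + ePV ΛV CPv 1 ε (Real.sqrt (8 * d * (1 + (d : ℝ) ^ 2)) * ((n : ℝ) * L * m₁)) * nsqV M φ := by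
  intro eH e₂ ε φ
  have hn : (0 : ℝ) < n := by exact_mod_cast Nat.pos_of_ne_zero (NeZero.ne n)
  have hε : 0 ≤ ε := by positivity
  have hδ : 0 ≤ Real.sqrt (8 * d * (1 + (d : ℝ) ^ 2)) * ((n : ℝ) * L * m₁) := by positivity
  exact vector_upper_bracket_min n L M (continuous_QvL n M Tk) (fun W => projG_nonneg (fine n M) Rc _ W) (continuous_projG (fine n M) Rc _)
    (fun W' => projG_nonneg (fine L (fine n M)) R' _ W') hΛV hCPv0 zero_le_one hε hδ
    (ρ := fun W => ScV n M Rc (projG (fine n M) Rc (LinearMap.ker (avgOp n M T))) W + nsqV M (QvL n M Tk W))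
    (fun W => add_nonneg (ScV_nonneg n M Rc (fun W => projG_nonneg (fine n M) Rc _ W) W) (nsqV_nonneg M _))
    hUBcV hPcV
    (hONEm_centred_reg n L M hd hT hT' hRc hR1 hTk hp hP hm hmis hm₁ hin hcross hΛ hCP hCR hUBc hUBf hPc hPf hREG hΛv hCGar hCGar' hCD hCD'
      hUBfV hPcV hGar hGdiv hREGV hs ht hu)
    (hREG_action n M) φ

end Summit.QuantumFields.BalabanUV.T4Continuum.VariationalVectorOneMinCentredBracket

end
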